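import Literature.MathematicalPhysics.QuantumFieldTheory.Balaban1983to89.B7Eq136SecondOrderPeriodic
import Literature.MathematicalPhysics.QuantumFieldTheory.Balaban1983to89.Node00.OpsYDelta2Form

/-!
# `Balaban1983to89.B9C2LettersTorusY` — [B9] p. 421 («The function C⁽²⁾(A) is defined at bonds of 𝔅, and on Λ_j it coincides with C_j⁽²⁾(LʲηA)») with [B7]
(136)∕(149): **THE RAW SECOND-ORDER DATUM AT NODE 00's CARRIERS** — the chart from def-Y's member torus (`CfgY ∕ FBondY ∕ IBondY`) to [B7]'s `ℤᵈ⁺¹` objects and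
the `U`-dependent family of `ℂ`-bilinear maps `rawFormY w U : (A, A′) ↦ (c ↦ w(c)·P_c(A, A′))`, `P_c` the torus polarisation of `C_{j(c)}⁽²⁾` at the coarse
bond underlying the index bond `c ∈ 𝔅` (`B7Eq136SecondOrderPeriodic.torusPol` read through the chart)

T. Bałaban, *Propagators for lattice gauge theories in a background field*, Commun. Math. Phys. **99** (1985) 389–434 [`Balaban1985BackgroundPropagators`, "B9"];
[B7] = [5] = T. Bałaban, *Averaging operations for lattice gauge theories*, Commun. Math. Phys. **98** (1985) 17–51 [`Balaban1985Averaging`]; [B12] = T. Bałaban,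
*Renormalization group approach to lattice gauge field theories. I*, Commun. Math. Phys. **109** (1987) 249–301 [`Balaban1987RG1`] ((0.1): the torus).
statement-level skeleton of published theorems with citation tags; proofs where landed; nothing here is a claim about the Yang–Mills mass gap.

THE PRINT.  [B9] p. 421: *«The function C⁽²⁾(A) is defined at bonds of 𝔅, and on Λ_j it coincides with C_j⁽²⁾(LʲηA) — a second order term in the expansion of
Q_j(ηA)»*; (3.134) p. 422 (Δ⁽²⁾ from C⁽²⁾); [B7] (136) p. 39, (149) p. 40, p. 24 (locality); [B12] (0.1) p. 251 (the torus `T_η`).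

THE CHART (def-Y's carriers ↔ [B7]'s).  A member's k-level index `i : KIdx` fixes the torus parameters `P = PV d ℓ i.m i.K` (Setup): fine sites
`Site P 0 = Fin (d+1) → ZMod T₀`, `T₀ = P.sitesPerDir 0 = 2(ℓ+1)^{m+K}`; fine bonds `FBondY i = PBond P 0 = ⟨src, dir⟩`; configurations `CfgY 𝔸 i = Fin (d+1) → Site P 0 → 𝔸ˣ`;
index bonds `IBondY i ∋ c = ⟨⟨j, b⟩, _⟩`, `b : PBond P j`, `b.src : Fin (d+1) → ZMod (P.sitesPerDir j)`, `P.sitesPerDir j = T₀ ∕ (ℓ+1)ʲ`.  Setup's block map is label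
division by `L = ℓ+1` (`Setup.blockOf`, B12's centred convention «in labels»), so the fine sites of the level-`j` site of label `y` are the labels `Lʲy + [0, Lʲ)ᵈ⁺¹` —
EXACTLY [B7]'s corner box `Bʲ(y)` (`B7Prop1Local.loK`) at `z := torusLift b.src` on the periodic extension: `readY U (z, μ) := U μ (z mod T₀)` (`B7AvgPeriodicity.proj`),
`fieldY A (w, μ) := A ⟨w, μ⟩`.  No identification of def-Y's averaging letters with [B7]'s is made or needed here: `rawFormY` is a DATUM for the letter `𝔠`.

WHAT THIS FILE PROVES (0 sorry; definitions with bodies `readY`, `fieldY`, `fieldYL`, `zOf`, `κOf`, `rawPolY`, `rawFormY`; theorems).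
* §1 the chart: `readY`, `readY_apply`, `readY_mem` (G-valued `U` ⇒ G-valued reading), `fieldY`, `fieldYL` (as a CLM), `fieldYL_apply`, `norm_fieldYL_le`,
  `fieldYL_star`, `fieldY_deltaY` (def-Y's `deltaY z a` reads as the torus delta `tDelta (z.src, z.dir) a`), `zOf`, `κOf`, `lvl_le_mK'`.
* §2 `rawPolY U c` (`P_c` through the chart, a continuous bilinear form on `FBondY i → 𝔸`), `rawPolY_apply`, ★ `rawFormY w U` (the `ℂ`-bilinear family
  `(A, A′) ↦ (c ↦ w c · P_c(A, A′))`), `rawFormY_apply`, `rawPolY_congr` (it sees `U` only on the box of `c`, via `torusPol_congr`).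
* §3 in [B7]'s regime AT THE RETRACTED READING (hypotheses of `B7Eq136SecondOrder` for a background `Û` agreeing with `readY U` on the box of `c` — supplied by
  `B7Eq52RetractionExtension` in the sequel): ★ `rawPolY_symm_of`, ★★ `norm_rawFormY_deltaY_le_of` — THE (149) ENTRY SHAPE AT def-Y's CARRIERS:
  `‖rawFormY w U A (deltaY z a) c‖ ≤ ‖w c‖·C₃·(Lʲ)²·‖A‖_∞·((Lʲ)^{−(d+1)}·N_c(z)·‖a‖)`, `N_c(z) ≤ 1`, and ★ `rawFormY_deltaY_eq_zero_of` (no box bond over `z` ⇒ entry `0`) —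
  the `(K, q)` data of `B9Delta2FormMajorantOf149.c2FormMaj_of_ineq149_symm` up to def-Y's geometry line «box bond over z ⇒ d(c, bI z) ≤ r».
CONVENTIONS OF RECORD (node00-def-Y WORD-94∕95, pub-ymgap bus 2026-08-30 I.33072∕I.33086): the slot `w c` is the home of the record's scalar `ε·s(j(c))` that makes
`w c • P_c(A, A′)` print's `C⁽²⁾(U; A, A′)(c)` ([B9] p. 421 after (3.127) with (3.12)∕(3.14) and [B7] (136)); this file keeps `w` GENERIC and the derivation line is carried
by def-Y's pin `Node00/OpsYC2OfRecord` (reserved).  NOT CLAIMED: that scalar; the gauge covariance `C2LettersY.IsCov` of the generated letter ((3.34); [B7]'s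
`R(u)`-covariance of `C_j` through the chart — a sequel, displayed at the pin meanwhile); the regime itself at members ((3.35)∕(3.36) ⇒ box
plaquette bound ⇒ `pdev` of the retraction — sequel); any identification of def-Y's `QY` with [B7]'s averaging.
-/

noncomputable section

open scoped BigOperators

namespace Literature.MathematicalPhysics.QuantumFieldTheory.Balaban1983to89.B9C2LettersTorusY

open Node00 (CfgY FBondY IBondY deltaY)
open B6KLevelCensusIndexV1 (KIdx)
open B6GlobalChartV1 (PV domT)
open B6Ineq2142KLevelV1 (lvl lvl_le_mK)
open B7Prop1Local (AgreeOn loK bondHiK)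
open B7Prop2Explicit (AvgClosed pdev C0 c2')
open B7Prop3Flat (c3)
open B7Prop5GeneralLevels (C3Gen thetaGen C1ppGen)
open B7AvgPeriodicity (proj torusLift proj_torusLift)
open B12Ineq417Flat (boxBonds)
open B7Eq136SecondOrderPeriodic (perExt boxRead torusPol torusPol_apply torusPol_congr torusPol_symm tDelta boxCount norm_torusPol_tDelta_le
  norm_torusPol_tDelta_le_of_period torusPol_tDelta_eq_zero boxCount_le_one)

variable {d ℓ : ℕ} {hd : 1 ≤ d + 1} {hL : Odd (ℓ + 1) ∧ 1 < ℓ + 1} {b₀ b₁ : ℝ}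

/-! ## §1 The chart -/

section Chart

variable (i : KIdx d ℓ hd hL b₀ b₁)

/-- the fine period `T₀ = 2L^{m+K}` of the member torus. [cite: Balaban1987RG1, (0.1) p.251, dictionary] -/
abbrev T0 : ℕ := (PV d ℓ i.m i.K hd hL).sitesPerDir 0

variable {𝔸 : Type} [NormedRing 𝔸] [NormedAlgebra ℂ 𝔸] [CompleteSpace 𝔸]

/-- **the periodic reading of a member configuration on `ℤᵈ⁺¹`**: `readY U (z, μ) = U μ (z mod T₀)`. [cite: Balaban1987RG1, (0.1) p.251] [cite: Balaban1985Averaging, p.19 («any other lattice»)] -/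
def readY (U : CfgY 𝔸 i) : B7Prop1Explicit.Site (d + 1) → Fin (d + 1) → 𝔸ˣ := fun z μ => U μ (proj (T0 i) z)

/-- the reading, evaluated. [cite: Balaban1987RG1, (0.1) p.251, bookkeeping] -/
@[simp] theorem readY_apply (U : CfgY 𝔸 i) (z : B7Prop1Explicit.Site (d + 1)) (μ : Fin (d + 1)) : readY i U z μ = U μ (proj (T0 i) z) := rfl

/-- a `G`-valued configuration reads as a `G`-valued configuration. [cite: Balaban1985BackgroundPropagators, (3.35) p.396 («U has values in G»), bookkeeping] -/
theorem readY_mem {G : Subgroup 𝔸ˣ} {U : CfgY 𝔸 i} (hU : ∀ μ x, U μ x ∈ G) (z : B7Prop1Explicit.Site (d + 1)) (μ : Fin (d + 1)) : readY i U z μ ∈ G :=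
  hU μ _

/-- **the fine-bond chart for fields**: a field on def-Y's fine bonds `⟨src, dir⟩` as a field on the torus bonds `(src, dir)` of `B7Eq136SecondOrderPeriodic`.
[cite: Balaban1987RG1, (0.1) p.251, dictionary] -/
def fieldY (A : FBondY i → 𝔸) : (Fin (d + 1) → ZMod (T0 i)) × Fin (d + 1) → 𝔸 := fun p => A ⟨p.1, p.2⟩

omit [NormedRing 𝔸] [NormedAlgebra ℂ 𝔸] [CompleteSpace 𝔸] in
/-- the field chart, evaluated. [cite: Balaban1987RG1, (0.1) p.251, bookkeeping] -/
@[simp] theorem fieldY_apply (A : FBondY i → 𝔸) (p : (Fin (d + 1) → ZMod (T0 i)) × Fin (d + 1)) : fieldY i A p = A ⟨p.1, p.2⟩ := rfl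

/-- the field chart as a continuous linear map. [cite: Balaban1987RG1, (0.1) p.251, bookkeeping] -/
def fieldYL : (FBondY i → 𝔸) →L[ℂ] ((Fin (d + 1) → ZMod (T0 i)) × Fin (d + 1) → 𝔸) :=
  ContinuousLinearMap.pi fun p => ContinuousLinearMap.proj (R := ℂ) (φ := fun _ : FBondY i => 𝔸) (⟨p.1, p.2⟩ : FBondY i)

omit [CompleteSpace 𝔸] in
/-- the CLM is the chart. [cite: Balaban1987RG1, (0.1) p.251, bookkeeping] -/
@[simp] theorem fieldYL_apply (A : FBondY i → 𝔸) : fieldYL i A = fieldY i A := rfl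

omit [CompleteSpace 𝔸] in
/-- the chart does not increase the sup norm (it is a relabelling). [cite: Balaban1987RG1, (0.1) p.251, bookkeeping] -/
theorem norm_fieldYL_le (A : FBondY i → 𝔸) : ‖fieldYL i A‖ ≤ ‖A‖ := by
  refine (pi_norm_le_iff_of_nonneg (norm_nonneg A)).2 fun p => ?_
  rw [fieldYL_apply, fieldY_apply]
  exact norm_le_pi_norm A _

omit [CompleteSpace 𝔸] in
/-- the chart commutes with the adjoint. [cite: Balaban1985Averaging, (22)–(23) p.21, bookkeeping] -/
theorem fieldYL_star [StarRing 𝔸] (A : FBondY i → 𝔸) : fieldYL i (star A) = star (fieldYL i A) := rfl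

omit [NormedAlgebra ℂ 𝔸] [CompleteSpace 𝔸] in
/-- def-Y's test delta reads as the torus delta: `fieldY (δ_z ⊗ a) = tDelta (z.src, z.dir) a`. [cite: Balaban1985BackgroundPropagators, (3.48) p.398, bookkeeping] -/
theorem fieldY_deltaY (z : FBondY i) (a : 𝔸) : fieldY i (deltaY z a) = tDelta (T0 i) (z.src, z.dir) a := by
  classical
  funext p
  simp only [fieldY_apply, deltaY, B7Eq136SecondOrderPeriodic.tDelta_apply]
  obtain ⟨w, μ⟩ := p
  obtain ⟨s, ν⟩ := z
  simp only [PBond.mk.injEq, Prod.mk.injEq]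
  exact if_congr Iff.rfl rfl rfl

/-- the [B7] coarse coordinates of an index bond `c = ⟨j, b⟩`: `z(c) := torusLift b.src ∈ ℤᵈ⁺¹` (labels in `[0, T₀∕Lʲ)`). [cite: Balaban1987RG1, (0.1) p.252 (labels), dictionary] -/
def zOf (c : IBondY i) : B7Prop1Explicit.Site (d + 1) := torusLift ((PV d ℓ i.m i.K hd hL).sitesPerDir (lvl i.hN i.D i.hk c)) c.1.2.src

/-- the direction of an index bond. [cite: Balaban1984PropagatorsII, (2.3) p.224, dictionary] -/
def κOf (c : IBondY i) : Fin (d + 1) := c.1.2.dir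

end Chart

/-! ## §2 The raw datum `rawFormY` -/

section Raw

variable (i : KIdx d ℓ hd hL b₀ b₁)
variable {𝔸 : Type} [NormedRing 𝔸] [NormedAlgebra ℂ 𝔸] [CompleteSpace 𝔸]

/-- **`P_c` THROUGH THE CHART**: the torus polarisation of `C_{j(c)}⁽²⁾` at the coarse bond `(z(c), κ(c))` underlying the index bond `c`, on def-Y's fine-bond fields,
over the background `readY U`. [cite: Balaban1985BackgroundPropagators, p.421 («on Λ_j it coincides with C_j⁽²⁾»)] [cite: Balaban1985Averaging, (136) p.39] -/
def rawPolY (U : CfgY 𝔸 i) (c : IBondY i) : (FBondY i → 𝔸) →L[ℂ] (FBondY i → 𝔸) →L[ℂ] 𝔸 :=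
  (torusPol (T0 i) (ℓ + 1) (readY i U) (lvl i.hN i.D i.hk c) (zOf i c) (κOf i c)).bilinearComp (fieldYL i) (fieldYL i)

/-- `P_c` through the chart, evaluated. [cite: Balaban1985Averaging, (136) p.39, bookkeeping] -/
theorem rawPolY_apply (U : CfgY 𝔸 i) (c : IBondY i) (A A' : FBondY i → 𝔸) :
    rawPolY i U c A A' = torusPol (T0 i) (ℓ + 1) (readY i U) (lvl i.hN i.D i.hk c) (zOf i c) (κOf i c) (fieldY i A) (fieldY i A') := rfl

/-- `P_c` reads the background only on the box of `c` (any `Û` agreeing with `readY U` there gives the same `rawPolY`). [cite: Balaban1985Averaging, p.24 (locality)] -/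
theorem rawPolY_congr (hℓ : 1 ≤ ℓ + 1) {U : CfgY 𝔸 i} {Uhat : B7Prop1Explicit.Site (d + 1) → Fin (d + 1) → 𝔸ˣ} (c : IBondY i)
    (h : AgreeOn (loK (ℓ + 1) (lvl i.hN i.D i.hk c) (zOf i c)) (bondHiK (ℓ + 1) (lvl i.hN i.D i.hk c) (zOf i c) (κOf i c)) (readY i U) Uhat)
    (A A' : FBondY i → 𝔸) :
    rawPolY i U c A A' = torusPol (T0 i) (ℓ + 1) Uhat (lvl i.hN i.D i.hk c) (zOf i c) (κOf i c) (fieldY i A) (fieldY i A') := by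
  rw [rawPolY_apply, torusPol_congr (T0 i) (ℓ + 1) hℓ (lvl i.hN i.D i.hk c) (zOf i c) (κOf i c) h]

/-- ★ **THE RAW DATUM `rawFormY w U`**: `(A, A′) ↦ (c ↦ w(c)·P_c(A, A′))` as a `ℂ`-bilinear map into index-bond functions — [B9] p. 421's «C⁽²⁾(A) on Λ_j = C_j⁽²⁾(LʲηA)»,
polarised, with the scale weights `w` (print's powers of `Lʲη`, def-Y's normalisation) left as a parameter. [cite: Balaban1985BackgroundPropagators, p.421, (3.134) p.422]
[cite: Balaban1985Variational, (56) p.286] -/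
def rawFormY (w : IBondY i → ℂ) (U : CfgY 𝔸 i) : (FBondY i → 𝔸) →ₗ[ℂ] (FBondY i → 𝔸) →ₗ[ℂ] (IBondY i → 𝔸) :=
  LinearMap.mk₂ ℂ (fun A A' => fun c => w c • rawPolY i U c A A')
    (fun A B A' => by funext c; simp only [map_add, FunLike.coe_add, Pi.add_apply, smul_add])
    (fun t A A' => by funext c; simp only [map_smul, FunLike.coe_smul, Pi.smul_apply, smul_comm t (w c)])
    (fun A A' B' => by funext c; simp only [map_add, smul_add, Pi.add_apply])
    (fun t A A' => by funext c; simp only [map_smul, Pi.smul_apply, smul_comm t (w c)])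

/-- the raw datum, evaluated. [cite: Balaban1985BackgroundPropagators, p.421, bookkeeping] -/
@[simp] theorem rawFormY_apply (w : IBondY i → ℂ) (U : CfgY 𝔸 i) (A A' : FBondY i → 𝔸) (c : IBondY i) :
    rawFormY i w U A A' c = w c • rawPolY i U c A A' := rfl

end Raw

/-! ## §3 In [B7]'s regime at a background agreeing with the reading on the box: symmetry and the (149) entries -/

section Regime

variable (i : KIdx d ℓ hd hL b₀ b₁)
variable {𝔸 : Type} [NormedRing 𝔸] [NormedAlgebra ℂ 𝔸] [CompleteSpace 𝔸] [NormOneClass 𝔸]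

variable (hℓ : 2 ≤ ℓ + 1) {G : Subgroup 𝔸ˣ} (hG : AvgClosed (d + 1) (ℓ + 1) G) {U : CfgY 𝔸 i} (c : IBondY i)
  {Uhat : B7Prop1Explicit.Site (d + 1) → Fin (d + 1) → 𝔸ˣ} (hUhat : ∀ x κ, Uhat x κ ∈ G)
  (hagree : AgreeOn (loK (ℓ + 1) (lvl i.hN i.D i.hk c) (zOf i c)) (bondHiK (ℓ + 1) (lvl i.hN i.D i.hk c) (zOf i c) (κOf i c)) (readY i U) Uhat)
  {α₀ : ℝ} (hα : 0 < α₀) (hα3 : C0 (d + 1) * α₀ ≤ 1 / 3) (hα4 : 4 * α₀ ≤ c2' (d + 1) (ℓ + 1))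
  (h52 : pdev Uhat < α₀ * ((((ℓ : ℝ) + 1) ^ lvl i.hN i.D i.hk c)⁻¹) ^ 2)
  {b : ℝ} (hb : 0 < b)
  (hsmall : Real.exp (4 * (800 * (((d + 1 : ℕ) : ℝ) + 1) ^ 2 * (((d + 1 : ℕ) : ℝ) + 4)) * α₀)
    * (1 + 8 * (131072 * (((d + 1 : ℕ) : ℝ) + 1) ^ 2) * (((ℓ : ℝ) + 1) ^ lvl i.hN i.D i.hk c * b)) ≤ 2)
  (hc₃ : 4 * (((ℓ : ℝ) + 1) ^ lvl i.hN i.D i.hk c * b) < c3 (d + 1) (ℓ + 1))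
  (h145 : 8 * ((d + 1 : ℕ) : ℝ) * thetaGen (d + 1) (ℓ + 1) α₀ * ((ℓ : ℝ) + 1)⁻¹ ^ 4 ≤ 1)
  (h155 : (2 * ((ℓ : ℝ) + 1) - 1) * ((ℓ : ℝ) + 1)⁻¹ ^ 2 + 2 * ((d + 1 : ℕ) : ℝ) * thetaGen (d + 1) (ℓ + 1) α₀ * ((ℓ : ℝ) + 1)⁻¹ ^ 3
    + 1 / 8 * (1 + 2 * ((d + 1 : ℕ) : ℝ) * thetaGen (d + 1) (ℓ + 1) α₀ * ((ℓ : ℝ) + 1)⁻¹ ^ 2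
      + 2 * ((d + 1 : ℕ) : ℝ) * C3Gen (d + 1) (ℓ + 1) * (((ℓ : ℝ) + 1) ^ lvl i.hN i.D i.hk c * b)) * ((ℓ : ℝ) + 1)⁻¹ ^ 2 ≤ 1)

include hℓ hG hUhat hagree hα hα3 hα4 h52 hb hsmall hc₃ in
/-- ★ **`P_c` IS SYMMETRIC** in [B7]'s regime at any `G`-valued background `Û` agreeing with the reading on the box of `c` ([B11] (56)).
[cite: Balaban1985Variational, (56) p.286] [cite: Balaban1985Averaging, (136) p.39, p.24] -/
theorem rawPolY_symm_of (A A' : FBondY i → 𝔸) : rawPolY i U c A A' = rawPolY i U c A' A := by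
  have hℓ1 : 1 ≤ ℓ + 1 := le_trans (by norm_num) hℓ
  have hL : ((ℓ + 1 : ℕ) : ℝ) = (ℓ : ℝ) + 1 := by push_cast; ring
  rw [rawPolY_congr i hℓ1 c hagree, rawPolY_congr i hℓ1 c hagree]
  exact torusPol_symm (T0 i) (ℓ + 1) hℓ hG (lvl i.hN i.D i.hk c) Uhat hUhat hα hα3 hα4 (by rw [hL]; exact h52) hb (by rw [hL]; exact hsmall)
    (by rw [hL]; exact hc₃) le_rfl (zOf i c) (κOf i c) _ _

include hℓ hG hUhat hagree hα hα3 hα4 h52 hb hsmall hc₃ h145 h155 in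
/-- ★★ **THE (149) ENTRIES AT def-Y's CARRIERS**: for every fine-bond field `A`, fine bond `z`, `a ∈ 𝔸` and index bond `c` (level `j = j(c) ≤ m + K`, so the box fits in
one period: `2Lʲ ≤ T₀ = 2L^{m+K}`), `‖rawFormY w U A (δ_z ⊗ a) c‖ ≤ ‖w c‖·C₃·(Lʲ)²·‖A‖_∞·((Lʲ)^{−(d+1)}·N_c(z)·‖a‖)` with `N_c(z) ≤ 1` the number of box bonds of `c`
over `z`. [cite: Balaban1985Averaging, (149) p.40, (141) p.39, (136) p.39] [cite: Balaban1985BackgroundPropagators, p.421, (3.136)–(3.137) pp.422–423] -/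
theorem norm_rawFormY_deltaY_le_of (w : IBondY i → ℂ) (A : FBondY i → 𝔸) (z : FBondY i) (a : 𝔸) :
    ‖rawFormY i w U A (deltaY z a) c‖ ≤
      ‖w c‖ * (C3Gen (d + 1) (ℓ + 1) * (((ℓ : ℝ) + 1) ^ lvl i.hN i.D i.hk c) ^ 2 * ‖A‖ *
        (((((ℓ : ℝ) + 1) ^ lvl i.hN i.D i.hk c) ^ (d + 1))⁻¹ *
          (boxCount (T0 i) (boxBonds (ℓ + 1) (lvl i.hN i.D i.hk c) (zOf i c) (κOf i c)) (z.src, z.dir) : ℝ) * ‖a‖)) := by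
  have hℓ1 : 1 ≤ ℓ + 1 := le_trans (by norm_num) hℓ
  have hL : ((ℓ + 1 : ℕ) : ℝ) = (ℓ : ℝ) + 1 := by push_cast; ring
  rw [rawFormY_apply, norm_smul, rawPolY_congr i hℓ1 c hagree, ← fieldYL_apply, ← fieldYL_apply i (deltaY z a)]
  refine mul_le_mul_of_nonneg_left ?_ (norm_nonneg _)
  have h := norm_torusPol_tDelta_le (T0 i) (ℓ + 1) hℓ hG (lvl i.hN i.D i.hk c) Uhat hUhat hα hα3 hα4 (by rw [hL]; exact h52) hb
    (by rw [hL]; exact hsmall) (by rw [hL]; exact hc₃) (by rw [hL]; exact h145) (by rw [hL]; exact h155) le_rfl (zOf i c) (κOf i c)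
    (fieldYL i A) (z.src, z.dir) a
  rw [fieldYL_apply i (deltaY z a), fieldY_deltaY]
  rw [hL] at h
  refine h.trans ?_
  have hC : 0 ≤ C3Gen (d + 1) (ℓ + 1) := by unfold C3Gen C1ppGen; positivity
  have hR : 0 ≤ ((((ℓ : ℝ) + 1) ^ lvl i.hN i.D i.hk c) ^ (d + 1))⁻¹ *
      (boxCount (T0 i) (boxBonds (ℓ + 1) (lvl i.hN i.D i.hk c) (zOf i c) (κOf i c)) (z.src, z.dir) : ℝ) * ‖a‖ := by positivity
  exact mul_le_mul_of_nonneg_right (mul_le_mul_of_nonneg_left (norm_fieldYL_le i A) (by positivity)) hR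

/-- the box of an index bond fits in one fine period: `2Lʲ ≤ T₀ = 2L^{m+K}` since `j(c) ≤ m + K`. [cite: Balaban1984PropagatorsII, (2.1) p.224, bookkeeping] -/
theorem two_mul_pow_lvl_le_T0 : 2 * (ℓ + 1) ^ lvl i.hN i.D i.hk c ≤ T0 i := by
  show 2 * (ℓ + 1) ^ lvl i.hN i.D i.hk c ≤ 2 * (ℓ + 1) ^ (i.m + i.K - 0)
  rw [Nat.sub_zero]
  exact Nat.mul_le_mul_left 2 (Nat.pow_le_pow_right (Nat.succ_pos ℓ) (lvl_le_mK i.hN i.D i.hk c))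

/-- `N_c(z) ≤ 1` at every index bond. [cite: Balaban1985Averaging, (141) p.39] [cite: Balaban1987RG1, (0.1) p.251] -/
theorem boxCount_lvl_le_one (z : FBondY i) :
    boxCount (T0 i) (boxBonds (ℓ + 1) (lvl i.hN i.D i.hk c) (zOf i c) (κOf i c)) (z.src, z.dir) ≤ 1 :=
  boxCount_le_one (T0 i) (ℓ + 1) (lvl i.hN i.D i.hk c) (two_mul_pow_lvl_le_T0 i c) (zOf i c) (κOf i c) _

include hℓ hG hUhat hagree hα hα3 hα4 h52 hb hsmall hc₃ h145 h155 in
/-- ★ **FAR FINE BONDS GIVE ZERO ENTRIES**: if no bond of the box of `c` lies over `z` then `rawFormY w U A (δ_z ⊗ a) c = 0`. [cite: Balaban1985Averaging, p.24 (locality), (149) p.40] -/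
theorem rawFormY_deltaY_eq_zero_of (w : IBondY i → ℂ) (A : FBondY i → 𝔸) {z : FBondY i}
    (hz : ∀ s ∈ boxBonds (ℓ + 1) (lvl i.hN i.D i.hk c) (zOf i c) (κOf i c), (proj (T0 i) s.1, s.2) ≠ (z.src, z.dir)) (a : 𝔸) :
    rawFormY i w U A (deltaY z a) c = 0 := by
  have hℓ1 : 1 ≤ ℓ + 1 := le_trans (by norm_num) hℓ
  have hL : ((ℓ + 1 : ℕ) : ℝ) = (ℓ : ℝ) + 1 := by push_cast; ring
  have h0 := torusPol_tDelta_eq_zero (T0 i) (ℓ + 1) hℓ hG (lvl i.hN i.D i.hk c) Uhat hUhat hα hα3 hα4 (by rw [hL]; exact h52) hb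
      (by rw [hL]; exact hsmall) (by rw [hL]; exact hc₃) (by rw [hL]; exact h145) (by rw [hL]; exact h155) le_rfl (zOf i c) (κOf i c)
      (fieldY i A) hz a
  rw [rawFormY_apply, rawPolY_congr i hℓ1 c hagree, fieldY_deltaY]
  exact (congrArg (fun t => w c • t) h0).trans (smul_zero _)

end Regime

end Literature.MathematicalPhysics.QuantumFieldTheory.Balaban1983to89.B9C2LettersTorusY
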